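import Summits.ABC.StewartYu.PadicG3TwoSizesN
import Summits.ABC.StewartYu.PadicG3TwoSizesThird
import HarnessLib

/-!
# Cell abc-stewartyu, WP-L.P(2) (crux r4 `PadicCoreTwoRat`, stmt-ABC-20504), record interface: CLOSED-FORM SIZES of the THIRD-STEP
# threshold of the schedule of record `schedTwoN` (`thirdDenSat`, `thirdMSat` with the virtual quotient denominator `DmOf (W3 …)`)

`Summits/ABC/StewartYu/PadicG3TwoSizesThirdN.lean` — cell `abc-stewartyu` (HOME `run/shared/lean/pub/abc-stewartyu/`), route
`YuMatveevShapeRat`, seat p3 (g10, WP-L.P(2) lead; memo-13 §1); sequel to `PadicG3TwoSizesN`.  One abbreviating definition (`ucolvN`)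
and theorems; no named fact.  Twin of p5's `PadicG3TwoSizesThird` on the Sat third-step structures of p3-g9
(`PadicG3TwoThirdStepSat.thirdDenSat/thirdMSat`, quotient bound `W3 (Bv3N I) Ucol s = (Bv·|s| + 2Ucol)/3`):
* `ucolvN = Σⱼ (Ucol j/N)·Voⱼ` (the basis slot in height units; `≤ (d+1)·ΣVo` when `Ucol ≤ (d+1)N`);
* `log_DmOf_W3_le` : `log DmOf(W3 (Bv3N I) Ucol s) ≤ (2/3)|s|·hboxvN I + (4/3)·ucolvN + 2ΣVo`;
* `log_thirdDenSat_schedTwoN_le` : `log thirdDenSat I s τ ≤ t₀·log ν(H) + |t|·log|b̃_θ| + (2/3)|s|·hboxvN I + (4/3)·ucolvN + 2ΣVo`;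
* `log_thirdMSat_schedTwoN_le` : `log thirdMSat I s τ ≤ log cardBN + (log cardBN + log Amax3N + log 2) + t₀·log 3 +
  (log 2 + log feldSizeN (I+1) |s| t₀) + |t|·log Xb3N I + (4/3)|s|·hboxvN I + (8/3)·ucolvN + 4ΣVo`;
* `log_heightProd_all` is p5's (`= hsumS`, a function of the set-up only).

WHAT THIS IS NOT: the bounds of `hboxvN`, `ucolvN`, `Xb3N`, `cardBN` in `P`-letters (sequel), the budget comparison; no crux moves.

References: K. Yu, Acta Math. 211 (2013), Lemma 5.4 (5.58)–(5.70); Yu. V. Nesterenko, LNM 1819 (2003), §4.3 (4.42)–(4.51), Lemma 3.11.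
-/

noncomputable section

open Finset Real
open Literature.NumberTheory.Transcendental
open Literature.NumberTheory.Transcendental.CW77 (heightProd hgt)
open Literature.NumberTheory.Transcendental.CW77.Setup (Tau tauNorm)

namespace Summit.ABC.StewartYu

namespace TwoSetup

open Summit.ABC.StewartYu.G3Boxes

variable (S : TwoSetup) (F : S.SatData) (P : PadicG3Par (S.d + 1)) (Ucol : Fin (S.d + 1) → ℕ)

/-- **The basis slot in height units**: `ucolvN = Σⱼ (Ucol j/N)·Voⱼ`. [folklore] -/
def ucolvN (Vo : Fin (S.d + 1) → ℝ) : ℝ := ∑ j, ((Ucol j : ℝ) / F.N) * Vo j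

/-- `0 ≤ ucolvN` for nonnegative weights. [folklore] -/
theorem ucolvN_nonneg {Vo : Fin (S.d + 1) → ℝ} (hVo : ∀ j, 0 ≤ Vo j) : 0 ≤ S.ucolvN F Ucol Vo := by
  unfold ucolvN
  exact Finset.sum_nonneg fun j _ => by have := hVo j; positivity

/-- `ucolvN ≤ (d+1)·ΣVo` when `Ucol j ≤ (d+1)·N`. [folklore] -/
theorem ucolvN_le {Vo : Fin (S.d + 1) → ℝ} (hVo : ∀ j, 0 ≤ Vo j) (hU : ∀ j, Ucol j ≤ (S.d + 1) * F.N) :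
    S.ucolvN F Ucol Vo ≤ ((S.d : ℝ) + 1) * ∑ j, Vo j := by
  unfold ucolvN
  rw [Finset.mul_sum]
  refine Finset.sum_le_sum fun j _ => mul_le_mul_of_nonneg_right ?_ (hVo j)
  have hN : (0 : ℝ) < F.N := by exact_mod_cast F.hN
  rw [div_le_iff₀ hN]
  exact_mod_cast hU j

/-- **The virtual quotient denominator of the third step**:
`log DmOf(W3 (Bv3N I) Ucol s) ≤ (2/3)|s|·hboxvN I + (4/3)·ucolvN + 2ΣVo`. [cite: Nesterenko2003, Lemma 3.11, §4.3 (4.42); shape only] -/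
theorem log_DmOf_W3_le {Vo : Fin (S.d + 1) → ℝ} (hVo : ∀ j, Height.logHeight₁ (F.αo j) ≤ Vo j) (I : ℕ) (s : ℤ) :
    Real.log (F.DmOf (SatData.W3 (S.Bv3N F P I) Ucol s) : ℝ) ≤
      2 / 3 * |(s : ℝ)| * S.hboxvN F P Vo I + 4 / 3 * S.ucolvN F Ucol Vo + 2 * ∑ j, Vo j := by
  have hVo0 : ∀ j, 0 ≤ Vo j := fun j => (Height.zero_le_logHeight₁ _).trans (hVo j)
  have h := F.log_DmOf_le_of_weights (SatData.W3 (S.Bv3N F P I) Ucol s) Vo hVo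
  refine h.trans ?_
  have hN : (0 : ℝ) < F.N := by exact_mod_cast F.hN
  have hs : ((s.natAbs : ℕ) : ℝ) = |(s : ℝ)| := by rw [Nat.cast_natAbs, Int.cast_abs]
  -- each `W3 j ≤ (Bv3N I j·|s| + 2 Ucol j)/3` as reals
  have hk : ∀ j, ((SatData.W3 (S.Bv3N F P I) Ucol s j : ℕ) : ℝ) ≤
      ((S.Bv3N F P I j : ℝ) * |(s : ℝ)| + 2 * Ucol j) / 3 := by
    intro j
    unfold SatData.W3
    have := Nat.cast_div_le (α := ℝ) (m := S.Bv3N F P I j * s.natAbs + 2 * Ucol j) (n := 3)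
    push_cast at this
    rw [hs] at this
    exact this
  have hterm : ∀ j, (((SatData.W3 (S.Bv3N F P I) Ucol s j : ℕ) : ℝ) / F.N + 1) * Vo j ≤
      ((((S.Bv3N F P I j : ℝ) * |(s : ℝ)| + 2 * Ucol j) / 3) / F.N + 1) * Vo j := fun j =>
    mul_le_mul_of_nonneg_right (by have := hk j; gcongr) (hVo0 j)
  have hsum := Finset.sum_le_sum fun j (_ : j ∈ Finset.univ) => hterm j
  refine (mul_le_mul_of_nonneg_left hsum (by norm_num)).trans (le_of_eq ?_)
  unfold hboxvN ucolvN
  rw [Finset.mul_sum, Finset.mul_sum, Finset.mul_sum, Finset.mul_sum, ← Finset.sum_add_distrib, ← Finset.sum_add_distrib]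
  exact Finset.sum_congr rfl fun j _ => by field_simp; ring

/-- **`log thirdDenSat I s τ`** of the schedule of record:
`≤ t₀·log ν(H) + |t|·log|b̃_θ| + (2/3)|s|·hboxvN I + (4/3)·ucolvN + 2ΣVo`. [cite: Yu2013, (5.35); shape only] -/
theorem log_thirdDenSat_schedTwoN_le {Vo : Fin (S.d + 1) → ℝ} (hVo : ∀ j, Height.logHeight₁ (F.αo j) ≤ Vo j)
    (I : ℕ) (s : ℤ) (τ : Tau S.d) :
    Real.log (thirdDenSat (S.schedTwoN F P) F (S.Bv3N F P) Ucol I s τ : ℝ) ≤ τ.1 * Real.log (Nat.lcmUpto P.H) +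
      (∑ j, τ.2 j : ℕ) * Real.log (|(S.bθ : ℝ)|) +
      (2 / 3 * |(s : ℝ)| * S.hboxvN F P Vo I + 4 / 3 * S.ucolvN F Ucol Vo + 2 * ∑ j, Vo j) := by
  unfold thirdDenSat
  rw [schedTwoN_den₀]
  have hν : (0 : ℝ) < (Nat.lcmUpto P.H : ℝ) := by exact_mod_cast Nat.lcmUpto_pos P.H
  have hb : (0 : ℝ) < |(S.bθ : ℝ)| := by rw [abs_pos]; exact_mod_cast S.bθ_ne
  have hmon : (0 : ℝ) < (F.DmOf (SatData.W3 (S.Bv3N F P I) Ucol s) : ℝ) := by exact_mod_cast F.one_le_DmOf _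
  have hbabs : ((S.bθ.natAbs : ℕ) : ℝ) = |(S.bθ : ℝ)| := by rw [Nat.cast_natAbs, Int.cast_abs]
  push_cast
  rw [hbabs, Real.log_mul (by positivity) hmon.ne', Real.log_mul (by positivity) (by positivity), Real.log_pow,
    Real.log_pow]
  have h := S.log_DmOf_W3_le F P Ucol hVo I s
  push_cast
  linarith

/-- **`log thirdMSat I s τ`** of the schedule of record, closed form. [cite: Yu2013, (5.38); shape only] -/
theorem log_thirdMSat_schedTwoN_le {Vo : Fin (S.d + 1) → ℝ} (hVo : ∀ j, Height.logHeight₁ (F.αo j) ≤ Vo j)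
    (I : ℕ) (s : ℤ) (τ : Tau S.d) :
    Real.log (thirdMSat (S.schedTwoN F P) F (S.Bv3N F P) Ucol I s τ) ≤
      Real.log (S.cardBN F P : ℝ) +
        (Real.log (S.cardBN F P : ℝ) + Real.log (S.Amax3N F P (S.one_le_T03N F P 0)) + Real.log 2) +
        τ.1 * Real.log 3 + (Real.log 2 + Real.log (S.feldSizeN F P (I + 1) |(s : ℝ)| τ.1)) +
        (∑ j, τ.2 j : ℕ) * Real.log (S.Xb3N F P I : ℝ) +
        2 * (2 / 3 * |(s : ℝ)| * S.hboxvN F P Vo I + 4 / 3 * S.ucolvN F Ucol Vo + 2 * ∑ j, Vo j) := by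
  have hVo0 : ∀ j, 0 ≤ Vo j := fun j => (Height.zero_le_logHeight₁ _).trans (hVo j)
  -- positivity of every factor
  have hc1 : (1 : ℝ) ≤ (S.cardBN F P : ℝ) := S.one_le_cardBN_real F P
  have hA1 : (1 : ℝ) ≤ S.Amax3N F P (S.one_le_T03N F P 0) := le_max_left _ _
  have hP1 : (1 : ℝ) ≤ ((S.schedTwoN F P).P : ℝ) := by exact_mod_cast S.one_le_P_schedTwoN F P
  have hM1 : (1 : ℝ) ≤ (S.M₀3N F P (I + 1) s τ : ℝ) := S.one_le_M₀3N F P _ s τ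
  have hX1 : (1 : ℝ) ≤ (S.Xb3N F P I : ℝ) := by exact_mod_cast S.one_le_Xb3N F P I
  have hmon1 : (1 : ℝ) ≤ (F.DmOf (SatData.W3 (S.Bv3N F P I) Ucol s) : ℝ) := by exact_mod_cast F.one_le_DmOf _
  have hf1 := S.one_le_feldSizeN F P (I + 1) (abs_nonneg (s : ℝ)) τ.1
  have hh := S.hboxvN_nonneg F P hVo0 I
  have hu := S.ucolvN_nonneg F Ucol hVo0
  have hsV : 0 ≤ ∑ j, Vo j := Finset.sum_nonneg fun j _ => hVo0 j
  -- the logs of the factors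
  have lP := S.log_P_schedTwoN_le F P
  have lM : Real.log (S.M₀3N F P (I + 1) s τ : ℝ) ≤ Real.log 2 + Real.log (S.feldSizeN F P (I + 1) |(s : ℝ)| τ.1) :=
    S.log_M₀3N_le F P (I + 1) le_rfl le_rfl
  have lmon := S.log_DmOf_W3_le F P Ucol hVo I s
  have hRHS : 0 ≤ Real.log (S.cardBN F P : ℝ) +
      (Real.log (S.cardBN F P : ℝ) + Real.log (S.Amax3N F P (S.one_le_T03N F P 0)) + Real.log 2) +
      τ.1 * Real.log 3 + (Real.log 2 + Real.log (S.feldSizeN F P (I + 1) |(s : ℝ)| τ.1)) +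
      (∑ j, τ.2 j : ℕ) * Real.log (S.Xb3N F P I : ℝ) +
      2 * (2 / 3 * |(s : ℝ)| * S.hboxvN F P Vo I + 4 / 3 * S.ucolvN F Ucol Vo + 2 * ∑ j, Vo j) := by
    have := Real.log_nonneg hc1; have := Real.log_nonneg hA1
    have := Real.log_nonneg hf1; have : 0 ≤ Real.log (2 : ℝ) := Real.log_nonneg (by norm_num)
    have : 0 ≤ Real.log (3 : ℝ) := Real.log_nonneg (by norm_num)
    have : 0 ≤ Real.log (S.Xb3N F P I : ℝ) := Real.log_nonneg hX1
    positivity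
  unfold thirdMSat
  rw [schedTwoN_cardB, schedTwoN_M₀, schedTwoN_Xb]
  rcases le_total ((S.cardBN F P : ℝ) * (S.schedTwoN F P).P *
      ((3 : ℝ) ^ τ.1 * (S.M₀3N F P (I + 1) s τ : ℝ) * (S.Xb3N F P I : ℝ) ^ (∑ j, τ.2 j) *
        ((F.DmOf (SatData.W3 (S.Bv3N F P I) Ucol s) : ℝ)) ^ 2)) 1 with h1 | h1
  · rw [max_eq_left h1, Real.log_one]; exact hRHS
  · rw [max_eq_right h1]
    rw [Real.log_mul (by positivity) (by positivity), Real.log_mul (by positivity) (by positivity),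
      Real.log_mul (by positivity) (by positivity), Real.log_mul (by positivity) (by positivity),
      Real.log_mul (by positivity) (by positivity), Real.log_pow, Real.log_pow, Real.log_pow]
    have hXlog : 0 ≤ Real.log (S.Xb3N F P I : ℝ) := Real.log_nonneg hX1
    push_cast
    nlinarith [lP, lM, lmon, hXlog]

end TwoSetup

end Summit.ABC.StewartYu

end
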